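import Summits.CriticalPhenomena.Ising3DConformalLimit.Theorems.CoerciveSharpnessDimensionPinnedTransfer
import HarnessLib

/-!
# Route `CoerciveSharpness`, crux `DimensionPinned` (item stmt-CriticalPhenomena-4662), line `Sketch`:
# the pointwise port `OctaveRatioRate → DimensionPinned` (registered stub `stub_pointwiseTransfer`)

The POINTWISE twin of the block transfer `stub_transfer` (same line, card `octave-telescoping-block-dock`,
"pointwise port"): a power rate for the SECOND DYADIC DIFFERENCES of `k ↦ log ⟨σ₀σ_{2^k e₀}⟩_{β_c(3)}`,
`|log g(2^{k+2}) - 2 log g(2^{k+1}) + log g(2^k)| ≤ C 2^{-θk}` (Li–Shiraishi's `b_{n+1} = b_n (1 + O(2^{-δn}))`,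
arXiv:1807.00541 §1.2), pins the exponent: the octave log-ratios `d_k` converge geometrically, so
`log g(2^K) - K d_∞` is BOUNDED, which is two-sided pure-power bounds along `2^k`; Messager–Miracle-Solé
antitonicity fills in all `n` and the sphere sandwich all directions (`Glue.dimensionPinned_of_axis_bounds`).
This is the dock for pointwise rate engines (e.g. a torus-uniform dyadic rate, card
`tensor-rg-dilatation-certificate`).  No definition, no notation.
-/

noncomputable section

namespace Summit.CriticalPhenomena.Ising3DConformalLimit.Theorems.CoerciveSharpnessDimensionPinned

open scoped BigOperators
open Filter Topology Finset
open Literature.Probability.LatticeModels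
open Summit.CriticalPhenomena.Ising3DConformalLimit.Theses.CoerciveSharpness (DimensionPinned)

namespace Glue

/-- **Second differences with a geometric rate force affine growth up to `O(1)`.** If
`|a(k+2) - 2a(k+1) + a(k)| ≤ C ρ^k` with `0 ≤ ρ < 1`, then `a k - k·d` is bounded for `d = lim (a(k+1) - a k)`.
[folklore] -/
theorem affine_of_second_diff_geometric {a : ℕ → ℝ} {C ρ : ℝ} (hρ0 : 0 ≤ ρ) (hρ1 : ρ < 1)
    (h : ∀ k : ℕ, |a (k + 2) - 2 * a (k + 1) + a k| ≤ C * ρ ^ k) :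
    ∃ d D : ℝ, ∀ k : ℕ, |a k - a 0 - k * d| ≤ D := by
  set δ : ℕ → ℝ := fun k => a (k + 1) - a k with hδ
  have hdist : ∀ k : ℕ, dist (δ k) (δ (k + 1)) ≤ C * ρ ^ k := by
    intro k
    rw [Real.dist_eq, abs_sub_comm]
    have e : δ (k + 1) - δ k = a (k + 2) - 2 * a (k + 1) + a k := by simp only [hδ]; ring
    rw [e]
    exact h k
  have hcs := cauchySeq_of_le_geometric ρ C hρ1 hdist
  obtain ⟨d, hd⟩ := cauchySeq_tendsto_of_complete hcs
  have hrate : ∀ k : ℕ, dist (δ k) d ≤ C * ρ ^ k / (1 - ρ) := fun k =>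
    by simpa [div_eq_mul_inv, mul_comm, mul_left_comm, mul_assoc] using
      dist_le_of_le_geometric_of_tendsto ρ C hρ1 hdist hd k
  -- `a k - a 0 - k d = Σ_{i<k} (δ i - d)`
  have htel : ∀ k : ℕ, a k - a 0 - k * d = ∑ i ∈ Finset.range k, (δ i - d) := by
    intro k
    induction k with
    | zero => simp
    | succ k ih =>
      rw [Finset.sum_range_succ, ← ih]
      simp only [hδ]
      push_cast
      ring
  have hC : 0 ≤ C := by
    have h0 := (abs_nonneg _).trans (h 0)
    simpa using h0
  refine ⟨d, C / (1 - ρ) * (1 - ρ)⁻¹, fun k => ?_⟩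
  rw [htel k]
  have h1ρ : 0 < 1 - ρ := by linarith
  calc |∑ i ∈ Finset.range k, (δ i - d)| ≤ ∑ i ∈ Finset.range k, |δ i - d| := Finset.abs_sum_le_sum_abs _ _
    _ ≤ ∑ i ∈ Finset.range k, C / (1 - ρ) * ρ ^ i := by
        refine Finset.sum_le_sum fun i _ => ?_
        have := hrate i
        rw [Real.dist_eq] at this
        calc |δ i - d| ≤ C * ρ ^ i / (1 - ρ) := this
          _ = C / (1 - ρ) * ρ ^ i := by ring
    _ = C / (1 - ρ) * ∑ i ∈ Finset.range k, ρ ^ i := by rw [Finset.mul_sum]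
    _ ≤ C / (1 - ρ) * (1 - ρ)⁻¹ := by
        refine mul_le_mul_of_nonneg_left ?_ (div_nonneg hC h1ρ.le)
        have := geom_sum_Ico_le_of_lt_one (m := 0) (n := k) hρ0 hρ1
        simpa using this

/-- **Dyadic fill-in, two-sided** (Messager–Miracle-Solé antitonicity between dyadic scales): bounds
`c (2^k)^{-s} ≤ g(2^k) ≤ C (2^k)^{-s}` for a positive antitone `g ≤ 1` give `c' n^{-s} ≤ g n ≤ C' n^{-s}`
for all `n ≥ 1` (and force `s ≥ 0`). This is `CensusWeb.axisPinned_of_dyadicPinned`. [folklore] -/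
theorem axis_of_dyadic {g : ℕ → ℝ} (hpos : ∀ n, 0 < g n) (hanti : Antitone g) (hle1 : ∀ n, g n ≤ 1)
    {s c C : ℝ} (hc : 0 < c)
    (hb : ∀ k : ℕ, c * ((2 : ℝ) ^ k) ^ (-s) ≤ g (2 ^ k) ∧ g (2 ^ k) ≤ C * ((2 : ℝ) ^ k) ^ (-s)) :
    ∃ c' C' : ℝ, 0 < c' ∧ ∀ n : ℕ, 1 ≤ n → c' * (n : ℝ) ^ (-s) ≤ g n ∧ g n ≤ C' * (n : ℝ) ^ (-s) := by
  -- the exponent is nonnegative (else the lower bound would exceed `g ≤ 1`)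
  have hs : 0 ≤ s := by
    by_contra hs
    push Not at hs
    have h1 : Tendsto (fun k : ℕ => ((2 : ℝ) ^ (-s)) ^ k) atTop atTop :=
      tendsto_pow_atTop_atTop_of_one_lt (Real.one_lt_rpow one_lt_two (by linarith))
    have h2 : Tendsto (fun k : ℕ => c * ((2 : ℝ) ^ (-s)) ^ k) atTop atTop :=
      Tendsto.const_mul_atTop hc h1
    obtain ⟨k, hk⟩ := (h2.eventually_gt_atTop 1).exists
    have h3 : c * ((2 : ℝ) ^ (-s)) ^ k ≤ 1 := by
      have h4 := (hb k).1.trans (hle1 (2 ^ k))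
      have e : ((2 : ℝ) ^ k) ^ (-s) = ((2 : ℝ) ^ (-s)) ^ k := by
        rw [← Real.rpow_natCast ((2 : ℝ) ^ (-s)) k, ← Real.rpow_mul (by norm_num : (0 : ℝ) ≤ 2),
          mul_comm, Real.rpow_mul (by norm_num : (0 : ℝ) ≤ 2), Real.rpow_natCast]
      rw [e] at h4
      exact h4
    linarith
  have hC : 0 ≤ C := by
    have h0 := (hpos (2 ^ 0)).trans_le (hb 0).2
    simp at h0
    exact h0.le
  refine ⟨c * (2 : ℝ) ^ (-s), C * (2 : ℝ) ^ s, by positivity, fun n hn => ?_⟩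
  set k := Nat.log 2 n with hk
  have h1 : 2 ^ k ≤ n := Nat.pow_log_le_self 2 (by omega)
  have h2 : n < 2 ^ (k + 1) := Nat.lt_pow_succ_log_self (by norm_num) n
  have hgn_lo : g (2 ^ (k + 1)) ≤ g n := hanti h2.le
  have hgn_hi : g n ≤ g (2 ^ k) := hanti h1
  have hnpos : (0 : ℝ) < n := by exact_mod_cast (show 0 < n by omega)
  have h2k : (0 : ℝ) < (2 : ℝ) ^ k := by positivity
  have h2s : (0 : ℝ) < (2 : ℝ) ^ s := by positivity
  constructor
  · have hcmp : ((n : ℝ)) ^ (-s) ≤ ((2 : ℝ) ^ k) ^ (-s) :=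
      Real.rpow_le_rpow_of_nonpos h2k (by exact_mod_cast h1) (neg_nonpos.2 hs)
    calc c * (2 : ℝ) ^ (-s) * (n : ℝ) ^ (-s) ≤ c * (2 : ℝ) ^ (-s) * ((2 : ℝ) ^ k) ^ (-s) := by
          apply mul_le_mul_of_nonneg_left hcmp
          positivity
      _ = c * ((2 : ℝ) ^ (k + 1)) ^ (-s) := by
          rw [pow_succ, Real.mul_rpow h2k.le (by norm_num)]
          ring
      _ ≤ g (2 ^ (k + 1)) := (hb (k + 1)).1
      _ ≤ g n := hgn_lo
  · have hcmp : ((2 : ℝ) ^ (k + 1)) ^ (-s) ≤ ((n : ℝ)) ^ (-s) :=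
      Real.rpow_le_rpow_of_nonpos hnpos (by exact_mod_cast h2.le) (neg_nonpos.2 hs)
    calc g n ≤ g (2 ^ k) := hgn_hi
      _ ≤ C * ((2 : ℝ) ^ k) ^ (-s) := (hb k).2
      _ = C * (2 : ℝ) ^ s * ((2 : ℝ) ^ (k + 1)) ^ (-s) := by
          rw [pow_succ, Real.mul_rpow h2k.le (by norm_num), Real.rpow_neg (by norm_num : (0 : ℝ) ≤ 2) s]
          field_simp
      _ ≤ C * (2 : ℝ) ^ s * (n : ℝ) ^ (-s) := by
          apply mul_le_mul_of_nonneg_left hcmp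
          positivity

end Glue

/-- **Registered stub `stub_pointwiseTransfer` of line `Sketch`: the pointwise port `OctaveRatioRate ⟹ crux`.**
A power rate for the second dyadic differences of `log ⟨σ₀σ_{2^k e₀}⟩_{β_c(3)}` implies two-sided pure-power
bounds for the critical two-point function on `ℤ³` (octave telescoping — Li–Shiraishi's `b_n` trick,
arXiv:1807.00541 §1.2 — then Messager–Miracle-Solé fill-in and sphere sandwich). [folklore] -/
theorem stub_pointwiseTransfer :
    (∃ θ C : ℝ, 0 < θ ∧ ∀ k : ℕ,
      |Real.log (criticalTwoPoint 3 (Pi.single 0 ((2 ^ (k + 2) : ℕ) : ℤ))) -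
          2 * Real.log (criticalTwoPoint 3 (Pi.single 0 ((2 ^ (k + 1) : ℕ) : ℤ))) +
        Real.log (criticalTwoPoint 3 (Pi.single 0 ((2 ^ k : ℕ) : ℤ)))| ≤ C * ((2:ℝ) ^ k) ^ (-θ)) →
    DimensionPinned := by
  rintro ⟨θ, C, hθ, h⟩
  let g : ℕ → ℝ := fun n => criticalTwoPoint 3 (Pi.single 0 (n : ℤ))
  have hgpos : ∀ n, 0 < g n := fun n => criticalTwoPoint_axis_pos n
  have hganti : Antitone g := fun _ _ hmn => criticalTwoPoint_axis_antitone hmn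
  have hgle1 : ∀ n, g n ≤ 1 := fun n => criticalTwoPoint_le_one' _
  -- the rate in geometric form
  set ρ : ℝ := (2 : ℝ) ^ (-θ) with hρ
  have hρ0 : 0 ≤ ρ := (Real.rpow_pos_of_pos two_pos _).le
  have hρ1 : ρ < 1 := Real.rpow_lt_one_of_one_lt_of_neg one_lt_two (neg_neg_of_pos hθ)
  have hρk : ∀ k : ℕ, ((2:ℝ) ^ k) ^ (-θ) = ρ ^ k := fun k => by
    rw [hρ, ← Real.rpow_natCast ((2 : ℝ) ^ (-θ)) k, ← Real.rpow_mul (by norm_num : (0 : ℝ) ≤ 2),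
      mul_comm, Real.rpow_mul (by norm_num : (0 : ℝ) ≤ 2), Real.rpow_natCast]
  set a : ℕ → ℝ := fun k => Real.log (g (2 ^ k)) with ha
  have h2 : ∀ k : ℕ, |a (k + 2) - 2 * a (k + 1) + a k| ≤ C * ρ ^ k := fun k => by
    rw [← hρk k]; exact h k
  obtain ⟨d, D, hD⟩ := Glue.affine_of_second_diff_geometric hρ0 hρ1 h2
  -- dyadic two-sided bounds with exponent `s := -d / log 2`
  have hlog2 : 0 < Real.log 2 := Real.log_pos one_lt_two
  set s : ℝ := -d / Real.log 2 with hs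
  have hdy : ∀ k : ℕ, Real.exp (a 0 - D) * ((2:ℝ) ^ k) ^ (-s) ≤ g (2 ^ k) ∧
      g (2 ^ k) ≤ Real.exp (a 0 + D) * ((2:ℝ) ^ k) ^ (-s) := by
    intro k
    have h2k : (0 : ℝ) < (2 : ℝ) ^ k := by positivity
    have hrpow : ((2 : ℝ) ^ k) ^ (-s) = Real.exp (k * d) := by
      rw [Real.rpow_def_of_pos h2k, Real.log_pow]
      congr 1
      simp only [hs]
      field_simp
    have hg : g (2 ^ k) = Real.exp (a k) := by simp only [ha]; exact (Real.exp_log (hgpos _)).symm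
    obtain ⟨hlo, hhi⟩ := abs_le.1 (hD k)
    rw [hrpow, hg, ← Real.exp_add, ← Real.exp_add, Real.exp_le_exp, Real.exp_le_exp]
    constructor <;> linarith
  obtain ⟨c', C', hc', hb⟩ :=
    Glue.axis_of_dyadic hgpos hganti hgle1 (Real.exp_pos _) hdy
  exact Glue.dimensionPinned_of_axis_bounds hc' hb

/-- The pointwise port typed as the item's home decl `ClusterRigidity.DimensionPinned`. [folklore] -/
theorem clusterRigidity_dimensionPinned_of_octaveRatioRate
    (h : ∃ θ C : ℝ, 0 < θ ∧ ∀ k : ℕ,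
      |Real.log (criticalTwoPoint 3 (Pi.single 0 ((2 ^ (k + 2) : ℕ) : ℤ))) -
          2 * Real.log (criticalTwoPoint 3 (Pi.single 0 ((2 ^ (k + 1) : ℕ) : ℤ))) +
        Real.log (criticalTwoPoint 3 (Pi.single 0 ((2 ^ k : ℕ) : ℤ)))| ≤ C * ((2:ℝ) ^ k) ^ (-θ)) :
    Summit.CriticalPhenomena.Ising3DConformalLimit.Theses.ClusterRigidity.DimensionPinned :=
  stub_pointwiseTransfer h

end Summit.CriticalPhenomena.Ising3DConformalLimit.Theorems.CoerciveSharpnessDimensionPinned
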